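import Literature.AlgebraicGeometry.HodgeTheory.BettiUniverseTraceIntegral
import Literature.AlgebraicGeometry.HodgeTheory.BettiUniverseTracePairing
import Literature.AlgebraicGeometry.HodgeTheory.DirectImageIsotopy
import Literature.AlgebraicGeometry.HodgeTheory.TransportedHodgeFiltrationOrthogonal
import Literature.NumberTheory.Transcendental.DeRhamTheoremMultiplicative
import Literature.Geometry.Kaehler.ManifoldFormsPullback
import Mathlib.LinearAlgebra.BilinearForm.Properties
import Mathlib.RingTheory.TensorProduct.Free
import HarnessLib

/-!
# Holonomy flat coordinates: the flat coordinates of a class family, read through a fibrewise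
# trivialisation, are fixed finite combinations of period integrals (Voisin I §9.2.1, §7.1.2)

Family `hodge`, layer `Literature/AlgebraicGeometry/HodgeTheory`; proof file (theorems only, no
definition, no named fact). Written by the prover seat `hodge-nonav-prover-Bx` (g14, cell `hodge-nonav`)
for prover-Ax's programme «GRIFFITHS-SURFACES» / «B4 RELATIVE RESIDUES» (route
`HodgeConjecture/CyclicUnitaryPowers`, `--supports stmt-HodgeConjecture-19544`), letter **F-D**.

The holomorphic-frame hypothesis `hw₂hol` of `exists_subbundleFrames_of_weightTwo` (`HodgeFramesOfWeightTwo`,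
the shape of the named fact `Griffiths1968_holomorphicHodgeSubbundles`) asks that, for a frame `w i t` of
`F²` of the transported Hodge structures `T^*H_t` read on the base fibre `ℂ ⊗_ℚ Hᵏ(X_s; ℚ)`, EVERY linear
functional `φ (w i t)` be holomorphic in `t`. This file reduces that to the holomorphy of finitely many
PERIOD INTEGRALS `t ↦ ∫_{M₀} α_t ∧ γ_j` on ONE compact model `M₀ = X_{t₁}^an` (the integrals treated by
prover-Ax's `PeriodIntegralHolomorphicVertical`), by three classical facts:

* §1 **Poincaré duality ⇒ flat coordinates are period integrals** (one variety):
  `BettiUniverse.exists_dual_eq_sum_mul_cintegral_wedge` — for `X` smooth projective of dimension `n`,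
  a Hodge model `B` with a MULTIPLICATIVE real de Rham comparison `e` and a continuous orientation `o`
  of `X^an` integrating some closed top form non-trivially (middle degree `k + k = 2n`): there are
  finitely many closed `k`-forms `γ_j` on `X^an` and, for every functional `φ` on `ℂ ⊗_ℚ Hᵏ(X(ℂ); ℚ)`,
  scalars `a_j` with `φ w = Σ_j a_j · ∫_{X^an} α ∧ γ_j` whenever `Θ_B w = (e ⊗ ℂ)[α]`. (The trace
  pairing `tr(x ∪ y)` is perfect over `ℚ`, `BettiUniverse.nondegenerate_tr_cup` = Hatcher Prop. 3.38,
  so the coordinates in a rational basis are `w ↦ tr_ℂ(w ∪ (1 ⊗ y_j))` for the dual partners `y_j`;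
  `Θ_B` is multiplicative (`HodgeModel.complexification_cup2`), `e ⊗ ℂ` is multiplicative
  (`cupProduct_complexifyFun_mk`, Warner Thm. 5.45) and `tr_ℂ = c · ∫` on the line `H^{2n}`
  (`BettiUniverse.exists_trC_eq_mul_cintegral`).)
* §2 **Transport inside a trivialised open is the holonomy of the trivialisation** (Voisin I §9.2.1
  Prop. 9.5; the tree's `transportFun_eq_of_isotopy` along each path):
  `transportFun_eq_of_fibrewiseTrivialisation` — for continuous fibre maps `Φ_t : Y → X_t(ℂ)`,
  `t ∈ W`, jointly continuous into `𝒳(ℂ)` and injective on `Hᵏ(·; ℂ)`, a family of classes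
  `c_t ∈ Hᵏ(X_t(ℂ); ℂ)` with CONSTANT pull-back `Φ_t^* c_t = a` is carried into itself by transport
  along every path inside `W`; hence (§3), for the continuations `T` of an admissible reference state
  `T₁` along paths inside `W` (the binder shape of `exists_subbundleFrames_of_weightTwo`),
  `Φ_t^* Θ'(T_ℂ v) = Φ_{t₁}^* Θ'((T₁)_ℂ v)` is independent of `t` and of `T`
  (`map_ofRatClassBaseChange_baseChange_eq_of_continuation`), and `T_ℂ⁻¹ x = (T₁)_ℂ⁻¹ y` as soon as
  `Φ_t^* Θ' x = Φ_{t₁}^* Θ' y` (`baseChange_symm_eq_of_continuation`) — the frame vectors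
  `w i t := T_ℂ⁻¹ x_{i,t}` are functions of `t` alone, read on `M₀` through `Φ_{t₁}`.
* §4 **Assembly** `dual_eq_sum_mul_cintegral_of_continuation`: with `B` a Hodge model of `X_{t₁}` and
  `Φ_{t₁} = B.toComplexPoints`, for every `φ` there are FIXED scalars `a_j` such that along every
  continuation `T` inside `W`: `Φ_t^* Θ'(T_ℂ v) = (e ⊗ ℂ)[α] ⟹ φ v = Σ_j a_j ∫_{M₀} α ∧ γ_j`.
* §5 **Cross-model naturality** `map_ofRatClassBaseChange_eq_complexifyFun_pullback`: if a class `x`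
  of `X` is represented on a Hodge model `A` by the closed form `β` for the INTEGRATION comparison
  (`Θ_A x = (∫ ⊗ ℂ)[β]`) and `Φ = A.toComplexPoints ∘ g` with `g : M₀ → X^an_A` smooth, then
  `Φ^* Θ' x = (∫ ⊗ ℂ)[g^* β]` on `M₀` (`integrationDeRhamIsoFamily_complexify_natural₂`, Lee Thm. 18.14)
  — so with `α := g_t^* β_t = Φ̃_t^* Ξ` the hypothesis of §4 is met by restrictions of ONE form `Ξ` on
  the total space, and the coordinates are the period integrals `∫_{M₀} Φ̃_t^* Ξ ∧ γ_j`.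

Only the middle degree `k = n` is treated (the equal-degree cup-product API of the light Betti–Hodge
universe; it is all the consumer — `Fⁿ Hⁿ` of a family of `n`-folds — needs). Honest scope: linear
algebra and bookkeeping of the tree's transport; nothing here says HC or any rung is proved.

## References

* [VoisinHodgeI2002] C. Voisin, Hodge Theory and Complex Algebraic Geometry I, CUP 2002, §5.3.2
  Thm. 5.30, §7.1.2 (Poincaré duality of the intersection form), §9.2.1 Prop. 9.5 (local systems and
  their trivialisation by Ehresmann's theorem), §10.2.1 Thm. 10.3.
* [HatcherAT2002] A. Hatcher, Algebraic Topology, CUP 2002, §3.3 Prop. 3.38.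
* [WarnerGTM94] F. Warner, Foundations of Differentiable Manifolds and Lie Groups, GTM 94, Springer
  1983, Thm. 5.45.
* [LeeSmoothManifolds2013] J. M. Lee, Introduction to Smooth Manifolds, 2nd ed. (2013), Thm. 18.14.
-/

noncomputable section

open scoped Manifold ContDiff TensorProduct unitInterval
open CategoryTheory Module
open Literature.AlgebraicTopology.SingularHomology
open Literature.Geometry.Kaehler
open Literature.NumberTheory.Transcendental
open Literature.AlgebraicGeometry.Motives (bettiCohomology ofRatClassBaseChange cintegral
  ComplexPoints fiberOver fiberι IsSmoothProjective)

-- The identification `TangentSpace I x = E` is an abuse of definitional equality; as in the tree's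
-- tangent-bundle files we let `isDefEq` unfold it.
set_option backward.isDefEq.respectTransparency false

namespace Literature.AlgebraicGeometry.HodgeTheory

/-! ### §1 Poincaré duality: flat coordinates are period integrals (one variety) -/

namespace BettiUniverse

section PoincareCoordinates

variable {n : ℕ} {X : Motives.SchemeOver ℂ}

/-- **Flat coordinates are period integrals.** Let `X` be smooth projective of dimension `n`, `B` a
Hodge model of `X` (carrier `X^an`), `e` a MULTIPLICATIVE real de Rham comparison on manifolds charted
on `B.model`, `k + k = 2n`, and `o` a continuous orientation of `X^an` integrating some closed top form
non-trivially. Then there are finitely many closed complex `k`-forms `γ_j` on `X^an` such that every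
`ℂ`-linear functional `φ` on `ℂ ⊗_ℚ Hᵏ(X(ℂ); ℚ)` has scalars `a_j` with
`φ w = Σ_j a_j · ∫_{X^an} α ∧ γ_j` for all `w` and all closed `k`-forms `α` with `Θ_B w = (e ⊗ ℂ)[α]`.
Proof: the trace pairing is perfect over `ℚ` (Hatcher Prop. 3.38), so the coordinate functionals of a
rational basis are `w ↦ tr_ℂ(w ∪ (1 ⊗ y_j))` for the Poincaré-dual partners `y_j`; represent
`Θ_B (1 ⊗ y_j)` by closed forms `γ_j`; `Θ_B` and `e ⊗ ℂ` are multiplicative and `tr_ℂ = c · ∫` on the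
line `H^{2n}`. [cite: VoisinHodgeI2002, §7.1.2 and §5.3.2 Thm. 5.30] [cite: HatcherAT2002, §3.3 Prop. 3.38]
[cite: WarnerGTM94, Thm. 5.45] -/
theorem exists_dual_eq_sum_mul_cintegral_wedge (hX : IsSmoothProjective n X) (B : HodgeModel n X)
    (e : DeRhamIsoFamily 𝓘(ℝ, B.model)) (hem : e.IsMultiplicative) {k : ℕ} (hk : k + k = 2 * n)
    [MeasurableSpace B.model] [BorelSpace B.model] [Fact (finrank ℝ B.model = k + k)]
    (o : (x : B.carrier) → Orientation ℝ (TangentSpace 𝓘(ℝ, B.model) x) (Fin (k + k)))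
    (ho : IsContinuousOrientation o)
    (hI : ∃ F : cclosedSmoothForms B.model B.carrier (k + k),
      cintegral o (F : MForm 𝓘(ℝ, B.model) B.carrier ℂ (k + k)) ≠ 0) :
    ∃ (N : ℕ) (γ : Fin N → cclosedSmoothForms B.model B.carrier k),
      ∀ φ : Module.Dual ℂ (ℂ ⊗[ℚ] bettiCohomology X k), ∃ a : Fin N → ℂ,
        ∀ (w : ℂ ⊗[ℚ] bettiCohomology X k) (α : cclosedSmoothForms B.model B.carrier k),
          B.complexification hX k w =
              complexifyFun e k (complexDeRhamCohomology.mk B.model B.carrier k α) →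
            φ w = ∑ j, a j * cintegral o ((α : MForm 𝓘(ℝ, B.model) B.carrier ℂ k).wedge
              (γ j : MForm 𝓘(ℝ, B.model) B.carrier ℂ k)) := by
  classical
  haveI : WedgeFacts 𝓘(ℝ, B.model) B.carrier ℝ :=
    wedgeFacts_of_assoc 𝓘(ℝ, B.model) B.carrier ℝ (ContinuousAlternatingMap.WedgeAssoc_holds ℝ B.model ℝ)
  haveI : WedgeFacts 𝓘(ℝ, B.model) B.carrier ℂ :=
    wedgeFacts_of_assoc 𝓘(ℝ, B.model) B.carrier ℂ (ContinuousAlternatingMap.WedgeAssoc_holds ℝ B.model ℂ)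
  -- `tr_ℂ = c · ∫` on the line `H^{2n}`
  obtain ⟨c, -, hc⟩ := exists_trC_eq_mul_cintegral hX B e hk o ho hI
  -- the middle degree: `k = n`, where the trace pairing is perfect over `ℚ`
  have hkn : k = n := by omega
  subst hkn
  haveI : Module.Finite ℚ (bettiCohomology X k) := BettiUniverse.finite hX k
  set Bq : LinearMap.BilinForm ℚ (bettiCohomology X k) :=
    LinearMap.compr₂ (cup X k k) (tr hX (k + k)) with hBq
  have hBqn : Bq.Nondegenerate := nondegenerate_tr_cup hX
  -- a rational basis and its Poincaré-dual partners: `tr (w ∪ y i) = (i-th coordinate of w)`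
  set b := Module.finBasis ℚ (bettiCohomology X k) with hb
  set y : Fin (finrank ℚ (bettiCohomology X k)) → bettiCohomology X k :=
    fun i ↦ (Bq.flip.toDual hBqn.flip).symm (b.coord i) with hy_def
  have hy : ∀ i w, tr hX (k + k) (cup X k k w (y i)) = b.coord i w := fun i w ↦ by
    have h := LinearMap.BilinForm.apply_toDual_symm_apply (hB := hBqn.flip) (b.coord i) w
    rw [LinearMap.BilinForm.flip_apply] at h
    exact h
  -- closed forms representing `Θ_B (1 ⊗ y i)`
  have hγex : ∀ i, ∃ γ : cclosedSmoothForms B.model B.carrier k,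
      B.complexification hX k ((1 : ℂ) ⊗ₜ[ℚ] y i) =
        complexifyFun e k (complexDeRhamCohomology.mk B.model B.carrier k γ) := fun i ↦ by
    obtain ⟨γ, hγ⟩ := complexDeRhamCohomology.mk_surjective
      ((e.complexifyEquiv B.carrier k).symm (B.complexification hX k ((1 : ℂ) ⊗ₜ[ℚ] y i)))
    refine ⟨γ, ?_⟩
    rw [← complexifyEquiv_apply, hγ, LinearEquiv.apply_symm_apply]
  choose γ hγ using hγex
  refine ⟨finrank ℚ (bettiCohomology X k), γ, fun φ ↦
    ⟨fun i ↦ c * φ ((1 : ℂ) ⊗ₜ[ℚ] b i), fun w α hw ↦ ?_⟩⟩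
  -- the complexified basis `1 ⊗ b i`; its coordinate functionals are the complexified trace pairings
  set bC := Algebra.TensorProduct.basis ℂ b with hbC
  have hcoord : ∀ i, bC.repr w i =
      trC hX (k + k) (LinearMap.BilinMap.baseChange ℂ (cup X k k) w ((1 : ℂ) ⊗ₜ[ℚ] y i)) := by
    intro i
    have hL : bC.coord i = trC hX (k + k) ∘ₗ
        (LinearMap.BilinMap.baseChange ℂ (cup X k k)).flip ((1 : ℂ) ⊗ₜ[ℚ] y i) := by
      refine bC.ext fun j ↦ ?_
      rw [Module.Basis.coord_apply, Module.Basis.repr_self, LinearMap.comp_apply,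
        LinearMap.flip_apply, hbC, Algebra.TensorProduct.basis_apply, LinearMap.BilinMap.baseChange_tmul,
        one_mul, trC_one_tmul, hy, Module.Basis.coord_apply, Module.Basis.repr_self]
      by_cases hij : j = i
      · subst hij
        simp
      · simp [hij]
    have := LinearMap.congr_fun hL w
    rwa [Module.Basis.coord_apply] at this
  -- `tr_ℂ (w ∪ (1 ⊗ y i)) = c · ∫ α ∧ γ i`
  have hpair : ∀ i, trC hX (k + k) (LinearMap.BilinMap.baseChange ℂ (cup X k k) w ((1 : ℂ) ⊗ₜ[ℚ] y i)) =
      c * cintegral o ((α : MForm 𝓘(ℝ, B.model) B.carrier ℂ k).wedge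
        (γ i : MForm 𝓘(ℝ, B.model) B.carrier ℂ k)) := by
    intro i
    have hcl : (α : MForm 𝓘(ℝ, B.model) B.carrier ℂ k).wedge (γ i : MForm 𝓘(ℝ, B.model) B.carrier ℂ k) ∈
        cclosedSmoothForms B.model B.carrier (k + k) :=
      wedge_mem_cclosedSmoothForms α.2 (γ i).2
    refine hc _ ⟨_, hcl⟩ ?_
    rw [B.complexification_cup2 hX, hw, hγ, cupProduct_complexifyFun_mk hem rfl]
    rfl
  -- expand `w` in the basis
  calc φ w = φ (∑ i, bC.repr w i • bC i) := by rw [bC.sum_repr]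
    _ = ∑ i, bC.repr w i * φ (bC i) := by simp only [map_sum, map_smul, smul_eq_mul]
    _ = ∑ i, (c * φ ((1 : ℂ) ⊗ₜ[ℚ] b i)) * cintegral o ((α : MForm 𝓘(ℝ, B.model) B.carrier ℂ k).wedge
          (γ i : MForm 𝓘(ℝ, B.model) B.carrier ℂ k)) := Finset.sum_congr rfl fun i _ ↦ by
        rw [hcoord, hpair, hbC, Algebra.TensorProduct.basis_apply]
        ring

/-- **The same, composed with a reference state.** For a linear isomorphism
`T₁ : Hᵏ(X'; ℚ) ≃ Hᵏ(X(ℂ); ℚ)` from some other rational space (the admissible reference state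
`Hᵏ(X_s; ℚ) ≃ Hᵏ(X_{t₁}; ℚ)` of a family, `X = X_{t₁}`): every functional `φ` on `ℂ ⊗_ℚ Hᵏ(X'; ℚ)` has
FIXED scalars `a_j` with `φ ((T₁)_ℂ⁻¹ y) = Σ_j a_j · ∫_{X^an} α ∧ γ_j` whenever `Θ_B y = (e ⊗ ℂ)[α]` —
the shape of the holomorphy clause `hw₂hol` of `exists_subbundleFrames_of_weightTwo` for frame vectors
`w i t := (T₁)_ℂ⁻¹ y_{i,t}` read on the reference fibre. [cite: VoisinHodgeI2002, §7.1.2 and §10.2.1]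
[cite: HatcherAT2002, §3.3 Prop. 3.38] -/
theorem exists_dual_baseChange_symm_eq_sum_mul_cintegral_wedge (hX : IsSmoothProjective n X)
    (B : HodgeModel n X) (e : DeRhamIsoFamily 𝓘(ℝ, B.model)) (hem : e.IsMultiplicative) {k : ℕ}
    (hk : k + k = 2 * n) [MeasurableSpace B.model] [BorelSpace B.model] [Fact (finrank ℝ B.model = k + k)]
    (o : (x : B.carrier) → Orientation ℝ (TangentSpace 𝓘(ℝ, B.model) x) (Fin (k + k)))
    (ho : IsContinuousOrientation o)
    (hI : ∃ F : cclosedSmoothForms B.model B.carrier (k + k),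
      cintegral o (F : MForm 𝓘(ℝ, B.model) B.carrier ℂ (k + k)) ≠ 0)
    {V' : Type*} [AddCommGroup V'] [Module ℚ V'] (T₁ : V' ≃ₗ[ℚ] bettiCohomology X k) :
    ∃ (N : ℕ) (γ : Fin N → cclosedSmoothForms B.model B.carrier k),
      ∀ φ : Module.Dual ℂ (ℂ ⊗[ℚ] V'), ∃ a : Fin N → ℂ,
        ∀ (y : ℂ ⊗[ℚ] bettiCohomology X k) (α : cclosedSmoothForms B.model B.carrier k),
          B.complexification hX k y =
              complexifyFun e k (complexDeRhamCohomology.mk B.model B.carrier k α) →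
            φ ((T₁.baseChange ℚ ℂ _ _).symm y) =
              ∑ j, a j * cintegral o ((α : MForm 𝓘(ℝ, B.model) B.carrier ℂ k).wedge
                (γ j : MForm 𝓘(ℝ, B.model) B.carrier ℂ k)) := by
  obtain ⟨N, γ, hγ⟩ := exists_dual_eq_sum_mul_cintegral_wedge hX B e hem hk o ho hI
  refine ⟨N, γ, fun φ ↦ ?_⟩
  obtain ⟨a, ha⟩ := hγ (φ ∘ₗ (T₁.baseChange ℚ ℂ _ _).symm.toLinearMap)
  exact ⟨a, fun y α hy ↦ by simpa only [LinearMap.comp_apply, LinearEquiv.coe_coe] using ha y α hy⟩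

end PoincareCoordinates

end BettiUniverse

/-! ### §2 Transport inside a trivialised open is the holonomy of the trivialisation -/

section Holonomy

variable {𝒳 S : Motives.SchemeOver ℂ} (π : 𝒳 ⟶ S) (k : ℕ) {U : Set (ComplexPoints S)}

/-- **Transport inside a trivialised open is the holonomy of the trivialisation** (Voisin I §9.2.1
Prop. 9.5: a `C⁰` trivialisation of the family over `W` trivialises the local system `Rᵏ π_* ℂ|_W`).
Data: a cohomologically locally trivial `U`, a subset `W ⊆ U`, a space `Y` and continuous fibre maps
`Φ_t : Y → X_t(ℂ)` (`t ∈ U`; used on `W` only) which are JOINTLY continuous on `Y × W` as a map to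
`𝒳(ℂ)` and injective on `Hᵏ(·; ℂ)` for `t ∈ W` (e.g. the fibre homeomorphisms of an Ehresmann
trivialisation); a family of classes `c_t ∈ Hᵏ(X_t(ℂ); ℂ)` whose pull-backs `Φ_t^* c_t = a` are
CONSTANT on `W`. Conclusion: transport along every path `ε` from `t₁` to `t` INSIDE `W` takes `c_{t₁}`
to `c_t` (`transportFun_eq_of_isotopy` for the isotopy `u ↦ Φ_{ε u}`).
[cite: VoisinHodgeI2002, §9.2.1 Prop. 9.5] -/
theorem transportFun_eq_of_fibrewiseTrivialisation (hU : IsCohomologicallyLocallyTrivialOn π U)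
    {Y : Type} [TopologicalSpace Y] {W : Set U}
    (Φ : ∀ t : U, C(Y, ComplexPoints (fiberOver π t.1)))
    (hcont : ContinuousOn
      (fun yt : Y × U ↦ Motives.AlgPoints.map (fiberι π yt.2.1) (Φ yt.2 yt.1)) (Set.univ ×ˢ W))
    (hinj : ∀ t ∈ W, Function.Injective (singularCohomology.map ℂ ℂ (Φ t) k))
    (c : ∀ t : U, complexBetti (fiberOver π t.1) k) (a : singularCohomology ℂ ℂ Y k)
    (hc : ∀ t ∈ W, singularCohomology.map ℂ ℂ (Φ t) k (c t) = a)
    {t₁ t : U} (ε : Path t₁ t) (hε : ∀ r, ε r ∈ W) :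
    transportFun π k hU ⟦ε⟧ (c t₁) = c t := by
  -- the isotopy `u ↦ Φ_{ε u}` over the path
  have hcont' : Continuous fun yu : Y × I ↦
      Motives.AlgPoints.map (fiberι π (ε yu.2).1) (Φ (ε yu.2) yu.1) := by
    have hmap : Continuous fun yu : Y × I ↦ ((yu.1, ε yu.2) : Y × U) :=
      continuous_fst.prodMk (ε.continuous.comp continuous_snd)
    have hmem : ∀ yu : Y × I, ((yu.1, ε yu.2) : Y × U) ∈ Set.univ ×ˢ W :=
      fun yu ↦ Set.mk_mem_prod (Set.mem_univ _) (hε yu.2)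
    have hcomp := hcont.comp_continuous hmap hmem
    exact hcomp
  have h0 : (⟨(ε 0).1, c (ε 0)⟩ : FiberClass π k) = ⟨t₁.1, c t₁⟩ := by rw [ε.source]
  have h1 : (⟨(ε 1).1, c (ε 1)⟩ : FiberClass π k) = ⟨t.1, c t⟩ := by rw [ε.target]
  exact transportFun_eq_of_isotopy π k hU ε (fun u ↦ Φ (ε u)) hcont' (fun u ↦ hinj _ (hε u))
    (fun u ↦ c (ε u)) a (fun u ↦ hc _ (hε u)) h0 h1

/-- **Uniqueness of flat families**: with the data of `transportFun_eq_of_fibrewiseTrivialisation` and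
`Φ_t^*` BIJECTIVE on `Hᵏ(·; ℂ)` for `t ∈ W`, a class `x ∈ Hᵏ(X_t(ℂ); ℂ)` obtained from
`x₁ ∈ Hᵏ(X_{t₁}(ℂ); ℂ)` by transport along a path inside `W` has the same reading on `Y`:
`Φ_t^* x = Φ_{t₁}^* x₁` (apply the previous theorem to the flat family `t' ↦ (Φ_{t'}^*)⁻¹ (Φ_{t₁}^* x₁)`).
[cite: VoisinHodgeI2002, §9.2.1 Prop. 9.5] -/
theorem map_transportFun_eq_of_fibrewiseTrivialisation (hU : IsCohomologicallyLocallyTrivialOn π U)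
    {Y : Type} [TopologicalSpace Y] {W : Set U}
    (Φ : ∀ t : U, C(Y, ComplexPoints (fiberOver π t.1)))
    (hcont : ContinuousOn
      (fun yt : Y × U ↦ Motives.AlgPoints.map (fiberι π yt.2.1) (Φ yt.2 yt.1)) (Set.univ ×ˢ W))
    (hbij : ∀ t ∈ W, Function.Bijective (singularCohomology.map ℂ ℂ (Φ t) k))
    {t₁ t : U} (ht₁ : t₁ ∈ W) (ε : Path t₁ t) (hε : ∀ r, ε r ∈ W)
    (x₁ : complexBetti (fiberOver π t₁.1) k) :
    singularCohomology.map ℂ ℂ (Φ t) k (transportFun π k hU ⟦ε⟧ x₁) =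
      singularCohomology.map ℂ ℂ (Φ t₁) k x₁ := by
  classical
  have ht : t ∈ W := by simpa using hε 1
  -- the flat family through `x₁`
  set a := singularCohomology.map ℂ ℂ (Φ t₁) k x₁ with ha
  set c : ∀ t' : U, complexBetti (fiberOver π t'.1) k := fun t' ↦
    if h : t' ∈ W then Classical.choose ((hbij t' h).2 a) else 0 with hc_def
  have hc : ∀ t' ∈ W, singularCohomology.map ℂ ℂ (Φ t') k (c t') = a := fun t' h ↦ by
    rw [hc_def]
    simp only [h, dite_true]
    exact Classical.choose_spec ((hbij t' h).2 a)
  have hc₁ : c t₁ = x₁ := (hbij t₁ ht₁).1 (by rw [hc t₁ ht₁])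
  have htr := transportFun_eq_of_fibrewiseTrivialisation π k hU Φ hcont (fun t' h ↦ (hbij t' h).1)
    c a hc ε hε
  rw [hc₁] at htr
  rw [htr, hc t ht]

end Holonomy

/-! ### §3 Continuations of an admissible state, read through the trivialisation -/

section Continuation

variable {𝒳 S : Motives.SchemeOver ℂ} (f : 𝒳 ⟶ S) (k : ℕ) {U : Set (ComplexPoints S)}

/-- **The continued classes have a constant reading on the model.** Setting of
`exists_subbundleFrames_of_weightTwo`: a reference state `T₁ : Hᵏ(X_s; ℚ) ≃ Hᵏ(X_{t₁}; ℚ)` and a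
continuation `T : Hᵏ(X_s; ℚ) ≃ Hᵏ(X_t; ℚ)` of it along a path `ε` from `t₁` to `t`
(`(T v) ⊗ 1 = ε_*((T₁ v) ⊗ 1)`), the path running inside an open `W` over which continuous fibre maps
`Φ_{t'} : Y → X_{t'}(ℂ)`, jointly continuous into `𝒳(ℂ)` and bijective on `Hᵏ(·; ℂ)`, are given. Then
for every `v ∈ ℂ ⊗_ℚ Hᵏ(X_s; ℚ)`: `Φ_t^* Θ'(T_ℂ v) = Φ_{t₁}^* Θ'((T₁)_ℂ v)` — independent of `t`, of
the path and of the continuation (`Θ' = ofRatClassBaseChange`; the complexified continuation IS the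
transport, `ofRatClassBaseChange_baseChange_eq_transportFun_of_transport`, and transport inside `W` is
the holonomy of `Φ`). [cite: VoisinHodgeI2002, §9.2.1 Prop. 9.5] -/
theorem map_ofRatClassBaseChange_baseChange_eq_of_continuation
    (hU : IsCohomologicallyLocallyTrivialOn f U) {Y : Type} [TopologicalSpace Y] {W : Set U}
    (Φ : ∀ t : U, C(Y, ComplexPoints (fiberOver f t.1)))
    (hcont : ContinuousOn
      (fun yt : Y × U ↦ Motives.AlgPoints.map (fiberι f yt.2.1) (Φ yt.2 yt.1)) (Set.univ ×ˢ W))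
    (hbij : ∀ t ∈ W, Function.Bijective (singularCohomology.map ℂ ℂ (Φ t) k))
    {s t₁ t : U} (ht₁ : t₁ ∈ W)
    (T₁ : singularCohomology ℚ ℚ (ComplexPoints (fiberOver f s.1)) k ≃ₗ[ℚ]
      singularCohomology ℚ ℚ (ComplexPoints (fiberOver f t₁.1)) k)
    (ε : Path t₁ t) (hε : ∀ r, ε r ∈ W)
    (T : singularCohomology ℚ ℚ (ComplexPoints (fiberOver f s.1)) k ≃ₗ[ℚ]
      singularCohomology ℚ ℚ (ComplexPoints (fiberOver f t.1)) k)
    (hT : ∀ v, ofRatClass _ k (T v) = transportFun f k hU ⟦ε⟧ (ofRatClass _ k (T₁ v)))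
    (v : ℂ ⊗[ℚ] singularCohomology ℚ ℚ (ComplexPoints (fiberOver f s.1)) k) :
    singularCohomology.map ℂ ℂ (Φ t) k
        (ofRatClassBaseChange (ComplexPoints (fiberOver f t.1)) k (T.toLinearMap.baseChange ℂ v)) =
      singularCohomology.map ℂ ℂ (Φ t₁) k
        (ofRatClassBaseChange (ComplexPoints (fiberOver f t₁.1)) k (T₁.toLinearMap.baseChange ℂ v)) := by
  -- the continuation from `t₁`: `T ∘ T₁⁻¹` is a transport along `ε`
  have hT' : ∀ u, ofRatClass _ k ((T₁.symm.trans T) u) = transportFun f k hU ⟦ε⟧ (ofRatClass _ k u) :=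
    fun u ↦ by rw [LinearEquiv.trans_apply, hT, LinearEquiv.apply_symm_apply]
  have hcomp : (T₁.symm.trans T).toLinearMap.baseChange ℂ (T₁.toLinearMap.baseChange ℂ v) =
      T.toLinearMap.baseChange ℂ v := by
    rw [← LinearMap.comp_apply, ← LinearMap.baseChange_comp]
    congr 1
    ext u
    simp
  rw [← hcomp, ofRatClassBaseChange_baseChange_eq_transportFun_of_transport f hU ⟦ε⟧ (T₁.symm.trans T) hT']
  exact map_transportFun_eq_of_fibrewiseTrivialisation f k hU Φ hcont hbij ht₁ ε hε _

/-- **The frame vectors are functions of `t` alone.** In the same setting: if `x ∈ ℂ ⊗_ℚ Hᵏ(X_t; ℚ)`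
and `y ∈ ℂ ⊗_ℚ Hᵏ(X_{t₁}; ℚ)` have the same reading on the model, `Φ_t^* Θ' x = Φ_{t₁}^* Θ' y`, then
`T_ℂ⁻¹ x = (T₁)_ℂ⁻¹ y` for EVERY continuation `T` of `T₁` along a path inside `W` (the previous
theorem, injectivity of `Φ_t^*` and of `Θ'`). [cite: VoisinHodgeI2002, §9.2.1 Prop. 9.5] -/
theorem baseChange_symm_eq_of_continuation
    (hU : IsCohomologicallyLocallyTrivialOn f U) {Y : Type} [TopologicalSpace Y] {W : Set U}
    (Φ : ∀ t : U, C(Y, ComplexPoints (fiberOver f t.1)))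
    (hcont : ContinuousOn
      (fun yt : Y × U ↦ Motives.AlgPoints.map (fiberι f yt.2.1) (Φ yt.2 yt.1)) (Set.univ ×ˢ W))
    (hbij : ∀ t ∈ W, Function.Bijective (singularCohomology.map ℂ ℂ (Φ t) k))
    {s t₁ t : U} (ht₁ : t₁ ∈ W)
    (T₁ : singularCohomology ℚ ℚ (ComplexPoints (fiberOver f s.1)) k ≃ₗ[ℚ]
      singularCohomology ℚ ℚ (ComplexPoints (fiberOver f t₁.1)) k)
    (ε : Path t₁ t) (hε : ∀ r, ε r ∈ W)
    (T : singularCohomology ℚ ℚ (ComplexPoints (fiberOver f s.1)) k ≃ₗ[ℚ]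
      singularCohomology ℚ ℚ (ComplexPoints (fiberOver f t.1)) k)
    (hT : ∀ v, ofRatClass _ k (T v) = transportFun f k hU ⟦ε⟧ (ofRatClass _ k (T₁ v)))
    {x : ℂ ⊗[ℚ] singularCohomology ℚ ℚ (ComplexPoints (fiberOver f t.1)) k}
    {y : ℂ ⊗[ℚ] singularCohomology ℚ ℚ (ComplexPoints (fiberOver f t₁.1)) k}
    (hxy : singularCohomology.map ℂ ℂ (Φ t) k (ofRatClassBaseChange _ k x) =
      singularCohomology.map ℂ ℂ (Φ t₁) k (ofRatClassBaseChange _ k y)) :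
    (T.baseChange ℚ ℂ _ _).symm x = (T₁.baseChange ℚ ℂ _ _).symm y := by
  have ht : t ∈ W := by simpa using hε 1
  -- `v := (T₁)_ℂ⁻¹ y` has `Φ_t^* Θ'(T_ℂ v) = Φ_{t₁}^* Θ' y = Φ_t^* Θ' x`, so `T_ℂ v = x`
  set v := (T₁.baseChange ℚ ℂ _ _).symm y with hv
  have h3 := map_ofRatClassBaseChange_baseChange_eq_of_continuation f k hU Φ hcont hbij ht₁ T₁ ε hε
    T hT v
  have hy : T₁.toLinearMap.baseChange ℂ v = y := by
    rw [← LinearEquiv.coe_baseChange, LinearEquiv.coe_coe, hv, LinearEquiv.apply_symm_apply]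
  rw [hy, ← hxy] at h3
  have hTx : T.toLinearMap.baseChange ℂ v = x :=
    ofRatClassBaseChange_injective _ k ((hbij t ht).1 h3)
  rw [LinearEquiv.symm_apply_eq]
  exact hTx.symm

end Continuation

/-! ### §4 Assembly: the flat coordinates along all continuations are fixed period combinations -/

section Assembly

variable {𝒳 S : Motives.SchemeOver ℂ} (f : 𝒳 ⟶ S) {n : ℕ} (k : ℕ) {U : Set (ComplexPoints S)}

/-- **Holonomy flat coordinates.** Let `f : 𝒳 ⟶ S` be cohomologically locally trivial over `U`, with
the fibre `X_{t₁}` smooth projective of dimension `n` (`k + k = 2n`), `B` a Hodge model of `X_{t₁}`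
(carrier `M₀ = X_{t₁}^an`) with a multiplicative real de Rham comparison `e` and a continuous
orientation `o` integrating some closed top form non-trivially; `W ∋ t₁` an open of `U` over which
continuous fibre maps `Φ_t : M₀ → X_t(ℂ)` are given, jointly continuous into `𝒳(ℂ)`, bijective on
`Hᵏ(·; ℂ)`, with `Φ_{t₁}` the comparison map of `B`; and `T₁ : Hᵏ(X_s; ℚ) ≃ Hᵏ(X_{t₁}; ℚ)` a reference
state. Then there are finitely many closed `k`-forms `γ_j` on `M₀` and, for every functional `φ` on
`ℂ ⊗_ℚ Hᵏ(X_s; ℚ)`, FIXED scalars `a_j` such that for every `t ∈ W`, every path `ε` from `t₁` to `t`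
inside `W`, every continuation `T` of `T₁` along `ε`, every `v` and every closed `k`-form `α` on `M₀`
with `Φ_t^* Θ'(T_ℂ v) = (e ⊗ ℂ)[α]`: `φ v = Σ_j a_j · ∫_{M₀} α ∧ γ_j`. (§1 on `X_{t₁}` for the
functional `φ ∘ (T₁)_ℂ⁻¹`, and §3.) With `α = Φ̃_t^* Ξ` for a form `Ξ` on the total space restricting to
representatives of the frame classes, these are the period integrals whose holomorphy in `t` is
`PeriodIntegralHolomorphicVertical`. [cite: VoisinHodgeI2002, §9.2.1 Prop. 9.5 and §7.1.2]
[cite: HatcherAT2002, §3.3 Prop. 3.38] [cite: WarnerGTM94, Thm. 5.45] -/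
theorem dual_eq_sum_mul_cintegral_of_continuation (hU : IsCohomologicallyLocallyTrivialOn f U)
    (hk : k + k = 2 * n) {s t₁ : U} (hX₁ : IsSmoothProjective n (fiberOver f t₁.1))
    (B : HodgeModel n (fiberOver f t₁.1)) (e : DeRhamIsoFamily 𝓘(ℝ, B.model)) (hem : e.IsMultiplicative)
    [MeasurableSpace B.model] [BorelSpace B.model] [Fact (finrank ℝ B.model = k + k)]
    (o : (x : B.carrier) → Orientation ℝ (TangentSpace 𝓘(ℝ, B.model) x) (Fin (k + k)))
    (ho : IsContinuousOrientation o)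
    (hI : ∃ F : cclosedSmoothForms B.model B.carrier (k + k),
      cintegral o (F : MForm 𝓘(ℝ, B.model) B.carrier ℂ (k + k)) ≠ 0)
    {W : Set U} (ht₁ : t₁ ∈ W) (Φ : ∀ t : U, C(B.carrier, ComplexPoints (fiberOver f t.1)))
    (hΦ₁ : ∀ y, Φ t₁ y = B.toComplexPoints y)
    (hcont : ContinuousOn
      (fun yt : B.carrier × U ↦ Motives.AlgPoints.map (fiberι f yt.2.1) (Φ yt.2 yt.1)) (Set.univ ×ˢ W))
    (hbij : ∀ t ∈ W, Function.Bijective (singularCohomology.map ℂ ℂ (Φ t) k))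
    (T₁ : singularCohomology ℚ ℚ (ComplexPoints (fiberOver f s.1)) k ≃ₗ[ℚ]
      singularCohomology ℚ ℚ (ComplexPoints (fiberOver f t₁.1)) k) :
    ∃ (N : ℕ) (γ : Fin N → cclosedSmoothForms B.model B.carrier k),
      ∀ φ : Module.Dual ℂ (ℂ ⊗[ℚ] singularCohomology ℚ ℚ (ComplexPoints (fiberOver f s.1)) k),
        ∃ a : Fin N → ℂ,
        ∀ t ∈ W, ∀ (ε : Path t₁ t), (∀ r, ε r ∈ W) →
          ∀ (T : singularCohomology ℚ ℚ (ComplexPoints (fiberOver f s.1)) k ≃ₗ[ℚ]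
            singularCohomology ℚ ℚ (ComplexPoints (fiberOver f t.1)) k),
          (∀ v, ofRatClass _ k (T v) = transportFun f k hU ⟦ε⟧ (ofRatClass _ k (T₁ v))) →
          ∀ (v : ℂ ⊗[ℚ] singularCohomology ℚ ℚ (ComplexPoints (fiberOver f s.1)) k)
            (α : cclosedSmoothForms B.model B.carrier k),
            singularCohomology.map ℂ ℂ (Φ t) k
                (ofRatClassBaseChange (ComplexPoints (fiberOver f t.1)) k (T.toLinearMap.baseChange ℂ v)) =
              complexifyFun e k (complexDeRhamCohomology.mk B.model B.carrier k α) →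
            φ v = ∑ j, a j * cintegral o ((α : MForm 𝓘(ℝ, B.model) B.carrier ℂ k).wedge
              (γ j : MForm 𝓘(ℝ, B.model) B.carrier ℂ k)) := by
  obtain ⟨N, γ, hγ⟩ := BettiUniverse.exists_dual_eq_sum_mul_cintegral_wedge hX₁ B e hem hk o ho hI
  refine ⟨N, γ, fun φ ↦ ?_⟩
  obtain ⟨a, ha⟩ := hγ (φ ∘ₗ (T₁.baseChange ℚ ℂ _ _).symm.toLinearMap)
  refine ⟨a, fun t ht ε hε T hT v α hα ↦ ?_⟩
  -- the reading of `(T₁)_ℂ v` on `M₀` through `Φ_{t₁} = B.toComplexPoints` is `(e ⊗ ℂ)[α]`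
  have hΦ₁' : (⟨B.toComplexPoints, B.isAnalytification.isHomeomorph.continuous⟩ :
      C(B.carrier, ComplexPoints (fiberOver f t₁.1))) = Φ t₁ :=
    ContinuousMap.ext fun y ↦ (hΦ₁ y).symm
  have hw : B.complexification hX₁ k (T₁.toLinearMap.baseChange ℂ v) =
      complexifyFun e k (complexDeRhamCohomology.mk B.model B.carrier k α) := by
    rw [B.complexification_apply, ← hα]
    change singularCohomology.map ℂ ℂ ⟨B.toComplexPoints, B.isAnalytification.isHomeomorph.continuous⟩ k
      _ = _
    rw [hΦ₁']
    exact (map_ofRatClassBaseChange_baseChange_eq_of_continuation f k hU Φ hcont hbij ht₁ T₁ ε hε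
      T hT v).symm
  have h := ha _ α hw
  rw [LinearMap.comp_apply, LinearEquiv.coe_coe, ← LinearEquiv.coe_baseChange, LinearEquiv.coe_coe,
    LinearEquiv.symm_apply_apply] at h
  exact h

end Assembly

/-! ### §5 Cross-model naturality for the integration comparison -/

section Naturality

variable {n : ℕ} {X : Motives.SchemeOver ℂ}

/-- **The reading through `Φ = (comparison) ∘ g` of a class represented by `β` is represented by
`g^* β`**, for the INTEGRATION de Rham comparisons of two model spaces: if `Θ_A x = (∫ ⊗ ℂ)[β]` on a
Hodge model `A` of the smooth projective `X`, `g : M₀ → X^an_A` is `C^∞` (`M₀` a Hausdorff σ-compact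
manifold charted on a complex model space `E`) and `Φ = A.toComplexPoints ∘ g`, then
`Φ^* Θ' x = (∫ ⊗ ℂ)[g^* β]` in `Hᵏ(M₀; ℂ)` — naturality of de Rham's theorem ACROSS model spaces
(`integrationDeRhamIsoFamily_complexify_natural₂`). For the fibre maps `Φ_t = A_t.toComplexPoints ∘ g_t`
of a smooth trivialisation and `β_t = j_t^* Ξ`, this supplies the hypothesis
`Φ_t^* Θ'(·) = (∫ ⊗ ℂ)[Φ̃_t^* Ξ]` of `dual_eq_sum_mul_cintegral_of_continuation`.
[cite: LeeSmoothManifolds2013, Thm. 18.14] [cite: VoisinHodgeI2002, §4.3.2 Rem. 4.48] -/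
theorem map_ofRatClassBaseChange_eq_complexifyFun_pullback (hX : IsSmoothProjective n X)
    (A : HodgeModel n X) [FiniteDimensional ℝ A.model]
    {E : Type} [NormedAddCommGroup E] [NormedSpace ℂ E] [FiniteDimensional ℂ E] [FiniteDimensional ℝ E]
    {M₀ : Type} [TopologicalSpace M₀] [ChartedSpace E M₀] [IsManifold 𝓘(ℝ, E) ∞ M₀] [T2Space M₀]
    [SigmaCompactSpace M₀]
    {g : M₀ → A.carrier} (hg : ContMDiff 𝓘(ℝ, E) 𝓘(ℝ, A.model) ∞ g)
    (Φ : C(M₀, ComplexPoints X)) (hΦ : ∀ y, Φ y = A.toComplexPoints (g y)) (k : ℕ)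
    (x : ℂ ⊗[ℚ] bettiCohomology X k) (β : cclosedSmoothForms A.model A.carrier k)
    (hx : A.complexification hX k x =
      complexifyFun (integrationDeRhamIsoFamily A.model) k (complexDeRhamCohomology.mk A.model A.carrier k β)) :
    singularCohomology.map ℂ ℂ Φ k (ofRatClassBaseChange (ComplexPoints X) k x) =
      complexifyFun (integrationDeRhamIsoFamily E) k (complexDeRhamCohomology.mk E M₀ k
        ⟨(β : MForm 𝓘(ℝ, A.model) A.carrier ℂ k).pullback 𝓘(ℝ, E) g, pullback_mem_cclosedSmoothForms hg β.2⟩) := by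
  have hΦeq : Φ = (⟨A.toComplexPoints, A.isAnalytification.isHomeomorph.continuous⟩ :
      C(A.carrier, ComplexPoints X)).comp ⟨g, hg.continuous⟩ := ContinuousMap.ext hΦ
  rw [hΦeq, singularCohomology.map_comp, ModuleCat.comp_apply]
  change singularCohomology.map ℂ ℂ ⟨g, hg.continuous⟩ k (A.pullback k (ofRatClassBaseChange _ k x)) = _
  rw [← A.complexification_apply hX, hx, ← complexify_apply, ← complexify_apply,
    ← complexDeRhamCohomology.map_mk hg, integrationDeRhamIsoFamily_complexify_natural₂ hg k]

end Naturality

end Literature.AlgebraicGeometry.HodgeTheory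

end
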